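import Summits.QuantumFields.BalabanUV.T4Continuum.Support.NE3DecomposedRepSfClass
import Summits.QuantumFields.BalabanUV.T4Continuum.Support.NE3DecomposedRepOfQuadLetter
import HarnessLib

/-!
# T⁴ programme, node NE3 — route Π, file 6aγ (ruling ρ-g26-1 (3)): `DecomposedRep` OVER `sfClass` AT A REGULAR MINIMISER PAIR FROM THE RESIDUAL SLICE
# REPRESENTATIVE, A SQUARE-SUMMABLE WEIGHT AND THE LOCAL QUADRATIC LETTER — class and window data DISCHARGED, sizes DOMINATED by k-free currencies;
# NO multi-level smallness, NO curvature line, NO fibre equation among the hypotheses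

NE3 (node U1b), row NE3 OWNER `b2b-balaban-t4-ne3-p1` (gen 26); ruling ρ-g26-1 (journal l.24615) after the disprover's D-ne3r2-g12-1 (the sup-currency (Π-REG) leaf is
dead for the pair; the currency of record is the path-sum one, supplied to the junction as the LOCAL QUADRATIC LETTER).  This is the currency-agnostic sibling of
file 6a `NE3DecomposedRepSfClass.decomposedRep_sfClass_of_leaves` (whose arithmetic §2 it reuses BY NAME) over the currency-agnostic junction 4γ
`NE3DecomposedRepOfQuadLetter.decomposedRep_of_quadLetter`.  Other inputs BY NAME: file 1 `NE3ResidualSliceRep.mem_sfClass_gaugeAct`, the class transport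
`MinimalActionRate.rescale_bavg_mem_sfClass`, `NE3EnergyRateWSupOfEndpointChart.cavg_mem_admissible_sfClass`, `GaugeFieldPerturbation.norm_fhol_sub_one_le_of_smallField`.

WHAT.  §1 `background_quad` (at a run-(j+2) admissible regular `U_B`: `W = cavg L U_B` is unitary, admissible for run `j+1`, window radius `x_j = ε∕(L^{j+1})²`) and
`window_gaugeAct` (`U_A^u = W·e^{X₀} ∈ sfClass (j+1)` by gauge invariance, so its window radius is `x_j` — NO multi-level smallness needed).  §2
**`decomposedRep_sfClass_of_quadLetter`**: at a pair (U_A minimiser of run j+1, U_B minimiser of run j+2, `Regular d L N b g (j+2) U_B`) of `sfClass d L N ε`, from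
[leaf Π-L1♮] `ResidualSliceRepT L N (j+1) (cavg L U_B) U_A u X₀ Nn α₀`, a WEIGHT `m ≥ 0` with `(L^{j+1})^d Σ m² ≤ C²·dirSq X₀`, THE LOCAL QUADRATIC LETTER
`‖dirIter L (j+1) (cavg L U_B) X₀ z κ‖ ≤ C₂((L^{j+1})·m z κ)²` (uniform `C₂ ≥ 0`), the letters of the linear normal part `Nn` ((R1)–(R4), sup `αN`, window sup-curl
`aN`), the k-FREE CURRENCIES `α₀·L^{j+1} ≤ α̂`, `m·L^{j+1} ≤ α̂` (pointwise), `C ≤ Ĉ`, `αN·L^{j+1} ≤ α̂N`, `aN·(L^{j+1})² ≤ âN`, FOUR uniform lines and the two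
uniform level lines — EXACTLY the per-pair clause of file 5b's `NE3ChartLettersMono.hchart_uniform_of_decomposedRep` with
`νb = (1+2048√(16d+1))·2√(c₁+c₂)·C₂·Ĉ·α̂`, `κ₁b = (4c₃+32768dc₄)·C₂·Ĉ²·â`, `κ₂b = 7224c₄·C₂·Ĉ²·â`,
`â = 3ε + 2âN + 8192(α̂+α̂N)α̂N + 48α̂² + 1300((α̂+α̂N) + (1+2048(α̂+α̂N))α̂N)²`.

HONEST FRAMING.  Bookkeeping and elementary real arithmetic over landed theorems; the representative, the weight, the quadratic letter (supplier of record: Π-C-3γ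
over the path-majorant leaf (Π-REG-γ), leaf-02 lineage), the letters of `Nn` (W6) and the numeric lines are HYPOTHESES; (P♮)_W's numeric lines, (H∃), T-E_w♯ and NE3
are NOT proved; spine PROVED 0∕9; finite T⁴ rung (B)+1 — NOT infinite volume, NOT mass gap, NOT `BetaPertH`, NOT Clay.  PLACEMENT: `Summits/QuantumFields/BalabanUV/`.
HONEST DEPENDENCY: continuum YM on T⁴ ⇐ BetaPertH ∧ nine spine estimates (0/9 proved); BetaPertH ⇐ (D1) ∧ (D4) ∧ CAP+tail; G-an2-4 gates asym, D1 and NE2/3/4.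
-/

set_option autoImplicit false

open scoped BigOperators Matrix.Norms.L2Operator
open NormedSpace Finset

namespace Summit.QuantumFields.BalabanUV.T4Continuum.NE3DecomposedRepSfClassQuad

open Set
open Literature.MathematicalPhysics.QuantumFieldTheory.Balaban1983to89
open B7Prop1Explicit B7Prop2Explicit
open T4AveragingDeficitWall (IsSkewDir IsUnitaryCfg SmallField vary curl curlSq dirSq dirL1 fhol)
open T4AveragingDeficitWallBoundary (periodBox)
open AveragingDeficitPeriodicCounting (IsPeriodicDir)
open AveragingDeficitChartCalculus (cavg)
open MinimalActionLevels (perWin)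
open MinimalActionSandwich (IsMinimiser admissible)
open MinimalActionRate (sfClass Regular rescale_bavg_mem_sfClass)
open NE3TangentCovariantTower (dirIter)
open NE3EnergyWeightedShapes (energyNormW)
open NE3FrameFreeSliceW (frameFreeBlockLandauW)
open NE3ProductPathChart (DecomposedRep)
open NE3ResidualSliceRep (normalPart mem_sfClass_gaugeAct)
open NE3DecomposedRepOfLinearNormalPart (ResidualSliceRepT)
open NE3DecomposedRepOfQuadLetter (decomposedRep_of_quadLetter)
open NE3DecomposedRepSfClass (levelRadius_rescale dom_three radius_dom exp_bracket_dom)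
open NE3EnergyRateWSupOfEndpointChart (cavg_mem_admissible_sfClass)
open GaugeFieldPerturbation (norm_fhol_sub_one_le_of_smallField)

noncomputable section

variable {d : ℕ} {n : Type*} [Fintype n] [DecidableEq n]

/-! ## §1 Background and window data over the class (no multi-level smallness) -/

/-- **THE BACKGROUND OF THE CURRENCY-AGNOSTIC JUNCTION OVER `sfClass`** at a run-`j+2` admissible regular `U_B`: `W = cavg L U_B` is unitary, admissible for run
`j+1`, and its plaquette variables are within `x_j = ε∕(L^{j+1})²` of `1`. [folklore] -/
theorem background_quad [Nonempty n] {L N : ℕ} (hL : 1 ≤ L) {ε b g : ℝ} (hb : 0 ≤ b)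
    (hbs : 512 * (d + 1) * (d + 4) * (L : ℝ) ^ 2 * b ≤ 1) (hbε' : b + 226 * (8 * (d + 1) * (d + 4)) ^ 2 * b ^ 2 ≤ ε)
    (j : ℕ) {V UB : Site d → Fin d → (Matrix n n ℂ)ˣ} (hB : UB ∈ admissible (sfClass d L N ε) L (j + 2) V) (hreg : Regular d L N b g (j + 2) UB) :
    IsUnitaryCfg (cavg L UB) ∧ cavg L UB ∈ admissible (sfClass d L N ε) L (j + 1) V ∧
      (∀ p ∈ perWin d (N * L ^ (j + 1)), ‖((fhol (cavg L UB) p : (Matrix n n ℂ)ˣ) : Matrix n n ℂ) - 1‖ ≤ ε / ((L : ℝ) ^ (j + 1)) ^ 2) := by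
  have hcl : cavg L UB ∈ sfClass d L N ε (j + 1) := rescale_bavg_mem_sfClass hL hb hbs hbε' hreg
  exact ⟨hcl.1, cavg_mem_admissible_sfClass hL hb hbs hbε' hB hreg, fun p _ => norm_fhol_sub_one_le_of_smallField hcl.2.2 p⟩

/-- **THE WINDOW RADIUS OF `U_A^u = W·e^{X₀}`** for an R-adapted residual slice representative over `sfClass`: the small-field class is gauge invariant, so
`W·e^{X₀} = U_A^u ∈ sfClass (j+1)` and its plaquette variables are within `x_j` of `1`. [folklore] -/
theorem window_gaugeAct [Nonempty n] {L N : ℕ} {ε : ℝ} (j : ℕ) {V UA W : Site d → Fin d → (Matrix n n ℂ)ˣ}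
    (hA : UA ∈ admissible (sfClass d L N ε) L (j + 1) V)
    {u : Site d → (Matrix n n ℂ)ˣ} {X₀ Nn : Site d → Fin d → Matrix n n ℂ} {α₀ : ℝ} (h : ResidualSliceRepT L N (j + 1) W UA u X₀ Nn α₀) :
    ∀ p ∈ perWin d (N * L ^ (j + 1)), ‖((fhol (vary W X₀ 1) p : (Matrix n n ℂ)ˣ) : Matrix n n ℂ) - 1‖ ≤ ε / ((L : ℝ) ^ (j + 1)) ^ 2 := by
  have h1 := mem_sfClass_gaugeAct h.gauge.1 h.gauge.2 hA.1
  rw [h.rep] at h1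
  exact fun p _ => norm_fhol_sub_one_le_of_smallField h1.2.2 p

/-! ## §2 `DecomposedRep` over `sfClass` from the representative, the weight and the quadratic letter -/

/-- **`DecomposedRep` OVER `sfClass` AT A REGULAR MINIMISER PAIR FROM THE RESIDUAL SLICE REPRESENTATIVE, A SQUARE-SUMMABLE WEIGHT AND THE LOCAL QUADRATIC
LETTER, WITH UNIFORMLY DOMINATED SIZES.**  See the module docstring; the conclusion is EXACTLY the per-pair clause of file 5b's
`NE3ChartLettersMono.hchart_uniform_of_decomposedRep`. [folklore] -/
theorem decomposedRep_sfClass_of_quadLetter [Nonempty n] {L N : ℕ} (hL : 1 ≤ L) (hN : 1 ≤ N) {ε b g : ℝ} (hb : 0 ≤ b)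
    (hε : 0 ≤ ε) (hbs : 512 * (d + 1) * (d + 4) * (L : ℝ) ^ 2 * b ≤ 1) (hbε' : b + 226 * (8 * (d + 1) * (d + 4)) ^ 2 * b ^ 2 ≤ ε)
    -- the pair
    (j : ℕ) {V UA UB : Site d → Fin d → (Matrix n n ℂ)ˣ} (hUA : IsMinimiser d (sfClass d L N ε) L N (j + 1) V UA)
    (hUB : IsMinimiser d (sfClass d L N ε) L N (j + 2) V UB) (hreg : Regular d L N b g (j + 2) UB)
    -- the residual slice representative [leaf]
    {u : Site d → (Matrix n n ℂ)ˣ} {X₀ Nn : Site d → Fin d → Matrix n n ℂ} {α₀ : ℝ}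
    (h : ResidualSliceRepT L N (j + 1) (cavg L UB) UA u X₀ Nn α₀)
    -- the square-summable weight and the local quadratic letter
    {m : Site d → Fin d → ℝ} {C C₂ : ℝ} (hm0 : ∀ z κ, 0 ≤ m z κ) (hC : 0 ≤ C) (hC₂ : 0 ≤ C₂)
    (hsq : ((L : ℝ) ^ (j + 1)) ^ d * ∑ z ∈ periodBox (d := d) N, ∑ κ : Fin d, m z κ ^ 2
      ≤ C ^ 2 * dirSq X₀ (periodBox (d := d) (N * L ^ (j + 1))))
    (hφ : ∀ z ∈ periodBox (d := d) N, ∀ κ : Fin d,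
      ‖dirIter L (j + 1) (cavg L UB) X₀ z κ‖ ≤ C₂ * ((L : ℝ) ^ (j + 1) * m z κ) ^ 2)
    -- the letters of the linear normal part against `φ := dirIter L (j+1) W X₀`
    {αN aN c₁ c₂ c₃ c₄ : ℝ} (hNP : IsPeriodicDir Nn ((N * L ^ (j + 1) : ℕ) : ℤ)) (hαN0 : 0 ≤ αN) (hNsup : ∀ y μ, ‖Nn y μ‖ ≤ αN)
    (haN0 : 0 ≤ aN) (haN : ∀ p ∈ perWin d (N * L ^ (j + 1)), ‖curl (cavg L UB) Nn p‖ ≤ aN)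
    (hc₁ : 0 ≤ c₁) (hc₂ : 0 ≤ c₂) (hc₃ : 0 ≤ c₃) (hc₄ : 0 ≤ c₄)
    (hR1 : dirSq Nn (periodBox (d := d) (N * L ^ (j + 1)))
      ≤ c₁ * (((L : ℝ) ^ (j + 1)) ^ d / ((L : ℝ) ^ (j + 1)) ^ 2) * dirSq (dirIter L (j + 1) (cavg L UB) X₀) (periodBox (d := d) N))
    (hR2 : curlSq (cavg L UB) Nn (periodBox (d := d) (N * L ^ (j + 1)))
      ≤ c₂ * (((L : ℝ) ^ (j + 1)) ^ d / ((L : ℝ) ^ (j + 1)) ^ 4) * dirSq (dirIter L (j + 1) (cavg L UB) X₀) (periodBox (d := d) N))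
    (hR3 : ∑ p ∈ perWin d (N * L ^ (j + 1)), ‖curl (cavg L UB) Nn p‖
      ≤ c₃ * (((L : ℝ) ^ (j + 1)) ^ d / ((L : ℝ) ^ (j + 1)) ^ 2) * dirL1 (dirIter L (j + 1) (cavg L UB) X₀) (periodBox (d := d) N))
    (hR4 : dirL1 Nn (periodBox (d := d) (N * L ^ (j + 1)))
      ≤ c₄ * (((L : ℝ) ^ (j + 1)) ^ d / (L : ℝ) ^ (j + 1)) * dirL1 (dirIter L (j + 1) (cavg L UB) X₀) (periodBox (d := d) N))
    -- k-free currencies of the pair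
    {αh Ch αNh aNh : ℝ} (hαh : α₀ * (L : ℝ) ^ (j + 1) ≤ αh) (hmh : ∀ z κ, m z κ * (L : ℝ) ^ (j + 1) ≤ αh) (hCh : C ≤ Ch)
    (hαNh : αN * (L : ℝ) ^ (j + 1) ≤ αNh) (haNh : aN * ((L : ℝ) ^ (j + 1)) ^ 2 ≤ aNh)
    -- uniform numeric lines
    (hℓ₁ : αh ≤ 1 / 100) (hℓ₃ : αNh ≤ 1 / 2700) (hℓ₄ : 10 * (αh + 24 * αNh) ≤ 1)
    (hℓ₅ : 2 * (c₁ + c₂) * C₂ ^ 2 * Ch ^ 2 * αh ^ 2 ≤ 1 / 2)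
    -- the level lines, uniform form
    {Λ CP : ℝ} (hCP : 0 ≤ CP)
    (hJ1 : (1 + 480 * Real.sqrt d * (αh + 24 * αNh)) ^ 2
      + 48 * d * (3 * ε + 2 * aNh + 8192 * (αh + αNh) * αNh + 48 * αh ^ 2 + 1300 * ((αh + αNh) + (1 + 2048 * (αh + αNh)) * αNh) ^ 2) ≤ Λ)
    (hJ2 : 112 * (d : ℝ) * (3 * ε + 2 * aNh + 8192 * (αh + αNh) * αNh + 48 * αh ^ 2 + 1300 * ((αh + αNh) + (1 + 2048 * (αh + αNh)) * αNh) ^ 2)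
      * CP ≤ 1 / (2 * (Fintype.card n : ℝ))) :
    IsUnitaryCfg (cavg L UB) ∧
    ∃ (u' : Site d → (Matrix n n ℂ)ˣ) (X N' : Site d → Fin d → Matrix n n ℂ) (α αN' ν κ₁ κ₂ a : ℝ),
      DecomposedRep (sfClass d L N ε) L N (j + 1) V UA UB u' X N' α αN' ν κ₁ κ₂ a ∧
      ν ≤ (1 + 2048 * Real.sqrt (16 * d + 1)) * (2 * Real.sqrt (c₁ + c₂) * C₂) * Ch * αh ∧
      κ₁ ≤ (4 * c₃ + 32768 * d * c₄) * C₂ * Ch ^ 2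
        * (3 * ε + 2 * aNh + 8192 * (αh + αNh) * αNh + 48 * αh ^ 2 + 1300 * ((αh + αNh) + (1 + 2048 * (αh + αNh)) * αNh) ^ 2) ∧
      κ₂ ≤ 7224 * c₄ * C₂ * Ch ^ 2
        * (3 * ε + 2 * aNh + 8192 * (αh + αNh) * αNh + 48 * αh ^ 2 + 1300 * ((αh + αNh) + (1 + 2048 * (αh + αNh)) * αNh) ^ 2) ∧
      α ≤ 1 / 40 ∧ αN' ≤ 1 / 100 ∧
      (1 + 24 * Real.sqrt d * (Real.exp (10 * (α + αN')) - 1) * (L : ℝ) ^ (j + 1)) ^ 2 + 48 * d * a * ((L : ℝ) ^ (j + 1)) ^ 2 ≤ Λ ∧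
      112 * (d : ℝ) * a * CP * ((L : ℝ) ^ (j + 1)) ^ 2 ≤ 1 / (2 * (Fintype.card n : ℝ)) := by
  have hL1r : (1 : ℝ) ≤ L := by exact_mod_cast hL
  -- §1 data
  obtain ⟨hWu, hadmW, hxW⟩ := background_quad hL hb hbs hbε' j hUB.mem hreg
  have hxA := window_gaugeAct j hUA.mem h
  -- basic facts (no abbreviations: every expression stays raw so that `linarith only` sees one atom per quantity)
  have hM1 : 1 ≤ (L : ℝ) ^ (j + 1) := one_le_pow₀ hL1r
  have hM0 : 0 < (L : ℝ) ^ (j + 1) := by positivity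
  have hxM : ((L : ℝ) ^ (j + 1)) ^ 2 * (ε / ((L : ℝ) ^ (j + 1)) ^ 2) = ε := (levelRadius_rescale hL ε j).2
  have hα₀0 : 0 ≤ α₀ := h.hα₀
  have hαh0 : 0 ≤ αh := le_trans (by positivity) hαh
  have hαNh0 : 0 ≤ αNh := le_trans (by positivity) hαNh
  have hx0 : 0 ≤ ε / ((L : ℝ) ^ (j + 1)) ^ 2 := by positivity
  -- the bare data are dominated by the currencies (`M ≥ 1`)
  have hα₀' : α₀ ≤ αh := (le_mul_of_one_le_right hα₀0 hM1).trans hαh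
  have hαN' : αN ≤ αNh := (le_mul_of_one_le_right hαN0 hM1).trans hαNh
  have hαN1 : αN ≤ 1 / 2700 := hαN'.trans hℓ₃
  -- the ceiling of the weight: `αm := α̂ ∕ L^{j+1}`
  have hmα : ∀ z κ, m z κ ≤ αh / (L : ℝ) ^ (j + 1) := fun z κ => by rw [le_div_iff₀ hM0]; exact hmh z κ
  have hα₀m : α₀ ≤ αh / (L : ℝ) ^ (j + 1) := by rw [le_div_iff₀ hM0]; exact hαh
  have hαmM : αh / (L : ℝ) ^ (j + 1) * (L : ℝ) ^ (j + 1) = αh := div_mul_cancel₀ αh hM0.ne'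
  have hαm1 : αh / (L : ℝ) ^ (j + 1) ≤ 1 / 100 := (div_le_self hαh0 hM1).trans hℓ₁
  have hJ1p : (αh / (L : ℝ) ^ (j + 1) + 43 * αN) * (L : ℝ) ^ (j + 1) ≤ 1 := by
    have : (αh / (L : ℝ) ^ (j + 1) + 43 * αN) * (L : ℝ) ^ (j + 1) = αh + 43 * (αN * (L : ℝ) ^ (j + 1)) := by
      rw [add_mul, hαmM]; ring
    rw [this]; linarith only [hαNh, hℓ₁, hℓ₃]
  have hC2 : C ^ 2 ≤ Ch ^ 2 := pow_le_pow_left₀ hC hCh 2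
  have hρ : 2 * (c₁ + c₂) * C₂ ^ 2 * C ^ 2 * (αh / (L : ℝ) ^ (j + 1) * (L : ℝ) ^ (j + 1)) ^ 2 ≤ 1 / 2 := by
    rw [hαmM]
    have hK : 0 ≤ 2 * (c₁ + c₂) * C₂ ^ 2 := by positivity
    exact (dom_three hK (sq_nonneg C) hC2 (sq_nonneg αh) le_rfl).trans hℓ₅
  -- the junction 4γ
  have hD := decomposedRep_of_quadLetter (𝒞 := sfClass d L N ε) hL hN j hWu hadmW h hm0 hC hC₂ hsq hmα hα₀m hαm1 hφ
    hNP hαN0 hNsup hαN1 hJ1p haN haN0 hc₁ hc₂ hc₃ hc₄ hR1 hR2 hR3 hR4 hρ hx0 hx0 hxW hxA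
  rw [hαmM] at hD
  -- the radius of the junction and its k-free domination
  have ha0 : 0 ≤ 2 * (ε / ((L : ℝ) ^ (j + 1)) ^ 2) + ε / ((L : ℝ) ^ (j + 1)) ^ 2 + 2 * aN + 4 * (2048 * (α₀ + αN) * αN)
      + 48 * α₀ ^ 2 + 1300 * ((α₀ + αN) + (1 + 2048 * (α₀ + αN)) * αN) ^ 2 := by positivity
  have haM := radius_dom (x := ε / ((L : ℝ) ^ (j + 1)) ^ 2) (aN := aN) (α₀ := α₀) (αN := αN) hM1 hα₀0 hαN0 hxM haNh hαh hαNh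
  have haM0 : 0 ≤ (2 * (ε / ((L : ℝ) ^ (j + 1)) ^ 2) + ε / ((L : ℝ) ^ (j + 1)) ^ 2 + 2 * aN + 4 * (2048 * (α₀ + αN) * αN)
      + 48 * α₀ ^ 2 + 1300 * ((α₀ + αN) + (1 + 2048 * (α₀ + αN)) * αN) ^ 2) * ((L : ℝ) ^ (j + 1)) ^ 2 :=
    mul_nonneg ha0 (by positivity)
  refine ⟨hWu, u, _, _, _, _, _, _, _, _, hD, ?_, ?_, ?_, ?_, ?_, ?_, ?_⟩
  · -- ν
    have hK : 0 ≤ (1 + 2048 * Real.sqrt (16 * d + 1)) * (2 * Real.sqrt (c₁ + c₂) * C₂) := by positivity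
    have h3 := dom_three hK hC hCh hαh0 le_rfl
    linarith only [h3]
  · -- κ₁
    have hK : 0 ≤ (4 * c₃ + 32768 * d * c₄) * C₂ := by positivity
    have h3 := dom_three hK (sq_nonneg C) hC2 haM0 haM
    linarith only [h3]
  · -- κ₂
    have hK : 0 ≤ 7224 * c₄ * C₂ := by positivity
    have h3 := dom_three hK (sq_nonneg C) hC2 haM0 haM
    linarith only [h3]
  · -- α = α₀ + αN ≤ 1∕40
    linarith only [hα₀', hℓ₁, hαN1]
  · -- αN' = (1 + 2048(α₀+αN))·αN ≤ 1∕100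
    have hf : 1 + 2048 * (α₀ + αN) ≤ 23 := by linarith only [hα₀', hℓ₁, hαN1]
    have h1 : (1 + 2048 * (α₀ + αN)) * αN ≤ 23 * αN := mul_le_mul_of_nonneg_right hf hαN0
    linarith only [h1, hαN1]
  · -- (J1)
    have hf : 1 + 2048 * (α₀ + αN) ≤ 23 := by linarith only [hα₀', hℓ₁, hαN1]
    have hs0 : 0 ≤ (α₀ + αN) + (1 + 2048 * (α₀ + αN)) * αN := by positivity
    have hsM : ((α₀ + αN) + (1 + 2048 * (α₀ + αN)) * αN) * (L : ℝ) ^ (j + 1) ≤ αh + 24 * αNh := by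
      have h1 : (1 + 2048 * (α₀ + αN)) * (αN * (L : ℝ) ^ (j + 1)) ≤ 23 * αNh := mul_le_mul hf hαNh (by positivity) (by norm_num)
      linarith only [h1, hαh, hαNh]
    have hbr := exp_bracket_dom hM1 hs0 hsM hℓ₄
    have hbr0 : 0 ≤ (Real.exp (10 * ((α₀ + αN) + (1 + 2048 * (α₀ + αN)) * αN)) - 1) * (L : ℝ) ^ (j + 1) := by
      have := Real.one_le_exp (by positivity : (0:ℝ) ≤ 10 * ((α₀ + αN) + (1 + 2048 * (α₀ + αN)) * αN))
      exact mul_nonneg (by linarith only [this]) hM0.le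
    have hd0 : 0 ≤ Real.sqrt d := Real.sqrt_nonneg _
    have h1 : 24 * Real.sqrt d * ((Real.exp (10 * ((α₀ + αN) + (1 + 2048 * (α₀ + αN)) * αN)) - 1) * (L : ℝ) ^ (j + 1))
        ≤ 24 * Real.sqrt d * (20 * (αh + 24 * αNh)) := mul_le_mul_of_nonneg_left hbr (by positivity)
    have hl0 : 0 ≤ 1 + 24 * Real.sqrt d * (Real.exp (10 * ((α₀ + αN) + (1 + 2048 * (α₀ + αN)) * αN)) - 1) * (L : ℝ) ^ (j + 1) := by
      have := mul_nonneg hd0 hbr0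
      linarith only [this]
    have hle : 1 + 24 * Real.sqrt d * (Real.exp (10 * ((α₀ + αN) + (1 + 2048 * (α₀ + αN)) * αN)) - 1) * (L : ℝ) ^ (j + 1)
        ≤ 1 + 480 * Real.sqrt d * (αh + 24 * αNh) := by linarith only [h1]
    have hsq' := pow_le_pow_left₀ hl0 hle 2
    have haM' := mul_le_mul_of_nonneg_left haM (by positivity : (0:ℝ) ≤ 48 * d)
    linarith only [hsq', haM', hJ1]
  · -- (J2)
    have h1 := mul_le_mul_of_nonneg_left haM (by positivity : (0:ℝ) ≤ 112 * (d : ℝ) * CP)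
    linarith only [h1, hJ2]

end

end Summit.QuantumFields.BalabanUV.T4Continuum.NE3DecomposedRepSfClassQuad
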